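import Summits.CriticalPhenomena.PercolationContinuityZ3.Theorems.Transplant.PlanarSkeletonFrmRayEsc
import HarnessLib

/-!
# Φ2 at the interface level, XVI: HULLS — finite UP-CLOSED regions of the big cylinder (any `PlanarSkeletonFrm`, any number of types)

builds on p205010 (kernel theorem, internal audit signed; external expert review pending) — nothing in this file uses p205010; nothing
here is a claim about any open node.
Lane `prim-bschramm`, seat `prim-bschramm-p4` gen 15 (PART C3 of `P4-GENERAL.md`, §37).  Helper file
(`--supports stmt-CriticalPhenomena-4575 --as helper`).  No probability.

The exhaustion of the big cylinder graph `G[C_{ℓ+3}(t)]` for the Aizenman–Grimmett / Menshikov setup of the sequel (`PlanarSkeletonFrmRayStrict`)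
is by HULLS: `hull S` = everything reachable from `S` by the two outward step maps `stpC 0`, `stpC 1` (file XV) applied at vertices of the
small box `Λ_ℓ`.  Hulls are up-closed by construction (`hull_closed`) — which is all the tail-based route lemma
`CycleKit.exists_routeData_of_pivotal_of_tails` (`SubgraphLocModCycleC`) asks of a region — and the hull of a finite set is FINITE
(`finite_hull`): the potential `φ₀ + φ₁` increases by one at each step and is at most `2ℓ` on `Λ_ℓ` (`gap`, `gap_stpC_lt`, `finite_reach` by
induction on the gap).  No partition of the cylinder into classes, no matching, no type hypothesis.
[cite: AizenmanGrimmett1991, Thm 1 (essential enhancements)] [cite: KozmaNitzan2024, §4 p. 15 (boxes and their translates)]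
-/

noncomputable section

namespace Summit.CriticalPhenomena.PercolationContinuityZ3.Theorems.Transplant

namespace PlanarSkeletonFrm

open SimpleGraph Walk Literature.Probability.LatticeModels
open scoped Classical

variable {V : Type} {G : SimpleGraph V} [G.LocallyFinite] (Φ : PlanarSkeletonFrm G)

section Cyl

variable {t : V} {ℓ : ℕ}

/-! ## §1 Reach and hull -/

/-- **The step successors** of a vertex of the big cylinder: `stpC 0 z` and `stpC 1 z` if `z` lies in `Λ_ℓ`, none otherwise. [folklore] -/
def stepSucc (t : V) (ℓ : ℕ) (z : Φ.cyl t (ℓ + 3)) : Set (Φ.cyl t (ℓ + 3)) :=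
  {w | Φ.φ z.1 - Φ.φ t ∈ box 2 ℓ ∧ (w = Φ.stpC t ℓ 0 z ∨ w = Φ.stpC t ℓ 1 z)}

/-- **The reach** of a vertex: everything obtained from it by iterated steps at inner vertices. [folklore] -/
def reach (t : V) (ℓ : ℕ) (z : Φ.cyl t (ℓ + 3)) : Set (Φ.cyl t (ℓ + 3)) :=
  {w | Relation.ReflTransGen (fun a b => b ∈ Φ.stepSucc t ℓ a) z w}

/-- **The hull** of a set: the union of the reaches of its elements. [folklore] -/
def hull (t : V) (ℓ : ℕ) (S : Set (Φ.cyl t (ℓ + 3))) : Set (Φ.cyl t (ℓ + 3)) := {w | ∃ z ∈ S, w ∈ Φ.reach t ℓ z}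

/-- A vertex lies in its reach. [folklore] -/
theorem mem_reach_self (z : Φ.cyl t (ℓ + 3)) : z ∈ Φ.reach t ℓ z := Relation.ReflTransGen.refl

/-- A set lies in its hull. [folklore] -/
theorem subset_hull (S : Set (Φ.cyl t (ℓ + 3))) : S ⊆ Φ.hull t ℓ S := fun z hz => ⟨z, hz, Φ.mem_reach_self z⟩

/-- Hulls are monotone. [folklore] -/
theorem hull_mono {S T : Set (Φ.cyl t (ℓ + 3))} (h : S ⊆ T) : Φ.hull t ℓ S ⊆ Φ.hull t ℓ T :=
  fun _ ⟨z, hz, hr⟩ => ⟨z, h hz, hr⟩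

/-- **Hulls are up-closed**: closed under both step maps at inner vertices. [folklore] -/
theorem hull_closed (S : Set (Φ.cyl t (ℓ + 3))) :
    ∀ z ∈ Φ.hull t ℓ S, Φ.φ z.1 - Φ.φ t ∈ box 2 ℓ → Φ.stpC t ℓ 0 z ∈ Φ.hull t ℓ S ∧ Φ.stpC t ℓ 1 z ∈ Φ.hull t ℓ S := by
  rintro z ⟨z₀, hz₀, hr⟩ hin
  exact ⟨⟨z₀, hz₀, Relation.ReflTransGen.tail hr ⟨hin, Or.inl rfl⟩⟩, ⟨z₀, hz₀, Relation.ReflTransGen.tail hr ⟨hin, Or.inr rfl⟩⟩⟩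

/-- The hull of a union. [folklore] -/
theorem hull_union (S T : Set (Φ.cyl t (ℓ + 3))) : Φ.hull t ℓ (S ∪ T) = Φ.hull t ℓ S ∪ Φ.hull t ℓ T := by
  ext w
  constructor
  · rintro ⟨z, hz | hz, hr⟩
    · exact Or.inl ⟨z, hz, hr⟩
    · exact Or.inr ⟨z, hz, hr⟩
  · rintro (⟨z, hz, hr⟩ | ⟨z, hz, hr⟩)
    · exact ⟨z, Or.inl hz, hr⟩
    · exact ⟨z, Or.inr hz, hr⟩

/-! ## §2 Finiteness -/

/-- **The potential gap**: `2ℓ + 1 − (φ₀ + φ₁)` (relative to `t`), truncated at `0`; it drops by one at every step from an inner vertex.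
[folklore] -/
def gap (t : V) (ℓ : ℕ) (z : Φ.cyl t (ℓ + 3)) : ℕ :=
  ((2 * ℓ : ℤ) + 1 - ((Φ.φ z.1 0 - Φ.φ t 0) + (Φ.φ z.1 1 - Φ.φ t 1))).toNat

/-- A step raises `φ₀ + φ₁` by one. [folklore] -/
theorem sum_φ_stp (i : Fin 2) (v : V) : Φ.φ (Φ.stp i v) 0 + Φ.φ (Φ.stp i v) 1 = Φ.φ v 0 + Φ.φ v 1 + 1 := by
  have hi : i = 0 ∨ i = 1 := by
    rcases i with ⟨i, hi⟩
    have : i = 0 ∨ i = 1 := by omega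
    rcases this with rfl | rfl
    · exact Or.inl rfl
    · exact Or.inr rfl
  rcases hi with rfl | rfl
  · rw [Φ.φ_stp_same, Φ.φ_stp_ne (show (1 : Fin 2) ≠ 0 by decide)]; ring
  · rw [Φ.φ_stp_same, Φ.φ_stp_ne (show (0 : Fin 2) ≠ 1 by decide)]; ring

/-- A step from an inner vertex lowers the gap. [folklore] -/
theorem gap_stpC_lt {z : Φ.cyl t (ℓ + 3)} (hin : Φ.φ z.1 - Φ.φ t ∈ box 2 ℓ) (i : Fin 2) :
    Φ.gap t ℓ (Φ.stpC t ℓ i z) < Φ.gap t ℓ z := by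
  have h2 := mem_box_two.1 hin
  simp only [Pi.sub_apply] at h2
  obtain ⟨h0, h1⟩ := h2
  rw [abs_le] at h0 h1
  have hv := Φ.stpC_val i (mem_box_add_two_of_mem_box hin)
  have hs := Φ.sum_φ_stp i z.1
  unfold gap
  rw [hv]
  omega

/-- The reach of a vertex decomposes along its first step. [folklore] -/
theorem reach_subset (z : Φ.cyl t (ℓ + 3)) :
    Φ.reach t ℓ z ⊆ {z} ∪ (Φ.reach t ℓ (Φ.stpC t ℓ 0 z) ∪ Φ.reach t ℓ (Φ.stpC t ℓ 1 z)) := by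
  intro w hw
  rcases Relation.ReflTransGen.cases_head_iff.1 hw with rfl | ⟨c, ⟨-, hc⟩, hcw⟩
  · exact Or.inl rfl
  · rcases hc with rfl | rfl
    · exact Or.inr (Or.inl hcw)
    · exact Or.inr (Or.inr hcw)

/-- A non-inner vertex reaches only itself. [folklore] -/
theorem reach_subset_of_not_inner {z : Φ.cyl t (ℓ + 3)} (h : Φ.φ z.1 - Φ.φ t ∉ box 2 ℓ) : Φ.reach t ℓ z ⊆ {z} := by
  intro w hw
  rcases Relation.ReflTransGen.cases_head_iff.1 hw with rfl | ⟨c, ⟨hin, -⟩, -⟩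
  · rfl
  · exact absurd hin h

/-- **The reach of a vertex is finite** (induction on the gap). [folklore] -/
theorem finite_reach : ∀ (n : ℕ) (z : Φ.cyl t (ℓ + 3)), Φ.gap t ℓ z ≤ n → (Φ.reach t ℓ z).Finite := by
  intro n
  induction n with
  | zero =>
    intro z hz
    refine (Set.finite_singleton z).subset (Φ.reach_subset_of_not_inner fun hin => ?_)
    have h2 := mem_box_two.1 hin
    simp only [Pi.sub_apply] at h2
    obtain ⟨h0, h1⟩ := h2
    rw [abs_le] at h0 h1
    have : 0 < Φ.gap t ℓ z := by unfold gap; omega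
    omega
  | succ n ih =>
    intro z hz
    by_cases hin : Φ.φ z.1 - Φ.φ t ∈ box 2 ℓ
    · refine ((Set.finite_singleton z).union ((ih _ ?_).union (ih _ ?_))).subset (Φ.reach_subset z)
      · have := Φ.gap_stpC_lt hin 0; omega
      · have := Φ.gap_stpC_lt hin 1; omega
    · exact (Set.finite_singleton z).subset (Φ.reach_subset_of_not_inner hin)

/-- **Hulls of finite sets are finite.** [folklore] -/
theorem finite_hull {S : Set (Φ.cyl t (ℓ + 3))} (hS : S.Finite) : (Φ.hull t ℓ S).Finite := by
  have : Φ.hull t ℓ S = ⋃ z ∈ S, Φ.reach t ℓ z := by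
    ext w; simp only [hull, Set.mem_setOf_eq, Set.mem_iUnion, exists_prop]
  rw [this]
  exact hS.biUnion fun z _ => Φ.finite_reach _ z le_rfl

end Cyl

end PlanarSkeletonFrm

end Summit.CriticalPhenomena.PercolationContinuityZ3.Theorems.Transplant

end
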